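import Literature.NumberTheory.Automorphic.QuadraticLocalBaseChange
import Mathlib.NumberTheory.NumberField.Completion.Ramification
import Mathlib.NumberTheory.NumberField.InfiniteAdeleRing
import Mathlib.LinearAlgebra.FiniteDimensional.Lemmas
import HarnessLib

/-!
# Quadratic base change at the archimedean places: `E ⊗_F F_v = ∏_{w ∣ v} E_w = F_v ⊕ F_v δ` (`v ∣ ∞`)
and `E_∞ = F_∞ ⊕ F_∞ δ`
(Cassels–Fröhlich, *Algebraic Number Theory* (1967), Ch. II §§9–10 (`L ⊗_K K_v ≅ ∏_{w ∣ v} L_w`, archimedean `v`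
included), §14 (`𝔸_L = 𝔸_K ⊗_K L`); Neukirch, *Algebraic Number Theory* (1999), Ch. II (8.3))

Topic `NumberTheory/Automorphic`; namespace `Literature.NumberTheory.Automorphic.UnitaryGroup` (companion of
`QuadraticLocalBaseChange`, which treats the finite places). Definitions and proved lemmas only: **no named facts,
0 proof holes**.

**Setting.** `E/F` number fields, `v` an infinite place of `F`; `InfPlacesOver E v` the (finite, non-empty) type of
infinite places `w` of `E` with `w|_F = v`, and `InfLocalRing E v = ∏_{w ∣ v} E_w` the archimedean analogue of the
tree's `UnitaryGroup.LocalRing E v`, i.e. the model of `E ⊗_F F_v` for `v ∣ ∞`.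

* §A `∏_{w ∣ v} E_w` as a topological `F_v`-algebra through `ι_w : F_v → E_w` (`toInfPlace`, Mathlib's
  `NumberField.LiesOver.completionMap` at the `LiesOver` witness of `w|_F = v`; `instance`s `Algebra`, `ContinuousSMul`,
  `Module.Finite` on each `E_w`); the **local degree formula** `dim_{F_v} ∏_{w ∣ v} E_w = ∑_{w ∣ v} [E_w : F_v] = [E : F]`
  (`finrank_infLocalRing`, from Mathlib's `NumberField.InfinitePlace.sum_inertiaDeg_eq_finrank`); **weak approximation**
  `E` dense in `∏_{w ∣ v} E_w` (`denseRange_algebraMap_infLocalRing`, Mathlib's `InfiniteAdeleRing.denseRange_algebraMap`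
  projected to the places above `v`); and the **quadratic case**: for `[Algebra.IsQuadraticExtension F E]` and `δ ∈ E ∖ F`
  the `F_v`-linear map `Ψ_v : F_v × F_v → ∏_{w ∣ v} E_w`, `(a, b) ↦ ι_v a + ι_v b · δ` is surjective (closed range
  containing the dense image of `E = F ⊕ F δ`) and injective (dimension count), whence
  **`quadraticInfLocalEquiv : (F_v × F_v) ≃L[F_v] ∏_{w ∣ v} E_w`** and
  `instance isQuadraticExtension_infLocalRing : Algebra.IsQuadraticExtension F_v (∏_{w ∣ v} E_w)`.
* §B the infinite adeles: `Ψ_∞ : F_∞ × F_∞ → E_∞`, `(a, b) ↦ (a ⊗ 1) + (b ⊗ 1) · δ` (`a ⊗ 1` the tree's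
  `InfiniteAdeleRing.baseChange`) is `Ψ_v` at the places above each `v` (`quadraticInfiniteAdeleMap_apply_placesOver`),
  hence bijective and bicontinuous: **`quadraticInfiniteAdeleEquiv : (F_∞ × F_∞) ≃ₜ+ E_∞`**, `(· ⊗ 1)`-semilinear
  (`quadraticInfiniteAdeleMap_smul`), with `δ · Ψ_∞ (a, b) = Ψ_∞ (d b, a)` for `δ² = d ∈ F`
  (`algebraMap_mul_quadraticInfiniteAdeleMap`).

Also recorded: `instance nontriviallyNormedField_completion : NontriviallyNormedField F_v` for `v ∣ ∞` (Mathlib has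
only `NormedField`; `‖2‖ = 2` through the isometric embedding into `ℂ`), needed for closed finite-dimensional subspaces.

## Mathlib / tree

Mathlib: `NumberField.InfinitePlace.Completion` (+ `LiesOver.completionMap`, `isometry_extensionEmbedding`),
`NumberField.InfinitePlace.placesOver` / `inertiaDeg` / `sum_inertiaDeg_eq_finrank` (`Completion/Ramification`),
`NumberField.InfiniteAdeleRing` (+ `denseRange_algebraMap`), `Submodule.closed_of_finiteDimensional`,
`LinearMap.injective_iff_surjective_of_finrank_eq_finrank`, `Module.finrank_pi_fintype`; Mathlib does not record
`L ⊗_K K_v ≅ ∏_{w ∣ v} L_w`. Tree: `AdeleBaseChange` (`infiniteCompletionOfComap`, `InfiniteAdeleRing.baseChange` and its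
`apply`/continuity/`algebraMap` lemmas), `QuadraticLocalBaseChange` (`exists_eq_add_mul_of_isQuadraticExtension`).

## Provenance

Written under the LEAN-IN-TREE rule (2026-08-18) for the pub-hodgecm formalisation cell (model-construction sub-cell,
base-change junction `E ⊗_F 𝔸_F = 𝔸_E`): the archimedean factor. Nothing in this file is a claim of the manuscripts
adjudicated by that cell.

## References

* J. W. S. Cassels, A. Fröhlich (eds.), *Algebraic Number Theory* (1967), Ch. II §§9–10, §14 [CasselsFrohlichANT1967].
* J. Neukirch, *Algebraic Number Theory*, Grundlehren 322 (1999), Ch. II (8.3) [Neukirch1999].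
-/

noncomputable section

open NumberField Topology Filter

namespace Literature.NumberTheory.Automorphic

namespace UnitaryGroup

variable {F : Type} (E : Type) [Field F] [NumberField F] [Field E] [NumberField E] [Algebra F E]

/-! ## A. Archimedean places: `E ⊗_F F_v = ∏_{w ∣ v} E_w = F_v ⊕ F_v δ` for `v ∣ ∞` -/

section Archimedean

open NumberField.InfinitePlace

/-- The infinite places `w` of `E` above the infinite place `v` of `F` (`w|_F = v`). [folklore] -/
abbrev InfPlacesOver (v : InfinitePlace F) : Type :=
  {w : InfinitePlace E // w.comap (algebraMap F E) = v}

/-- `E ⊗_F F_v` for `v ∣ ∞`, realised as `∏_{w ∣ v} E_w` (Cassels–Fröhlich II §§9–10). [cite: CasselsFrohlichANT1967, Ch. II §10] -/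
abbrev InfLocalRing (v : InfinitePlace F) : Type :=
  (w : InfPlacesOver E v) → w.1.Completion

variable (v : InfinitePlace F)

omit [NumberField F] in
/-- There are finitely many places above `v` (instance). [folklore] -/
instance fintypeInfPlacesOver : Fintype (InfPlacesOver E v) := Fintype.ofFinite _

omit [NumberField F] [NumberField E] in
/-- `w ∣ v` for `w : InfPlacesOver E v`, as a `LiesOver` instance of the underlying absolute values. [folklore] -/
theorem InfPlacesOver.liesOver (w : InfPlacesOver E v) : w.1.1.LiesOver v.1 :=
  ⟨congrArg Subtype.val w.2⟩

omit [NumberField F] [NumberField E] in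
/-- `w ∈ placesOver E v ↔ w|_F = v` (Mathlib's `placesOver` versus `InfPlacesOver`). [folklore] -/
theorem mem_placesOver_iff (w : InfinitePlace E) : w ∈ v.placesOver E ↔ w.comap (algebraMap F E) = v :=
  ⟨fun h => @NumberField.InfinitePlace.LiesOver.comap_eq F E _ _ _ w v h, fun h => ⟨congrArg Subtype.val h⟩⟩

omit [NumberField E] in
/-- Some infinite place of `E` lies above `v` (instance). [folklore] -/
instance InfPlacesOver.nonempty [Algebra.IsQuadraticExtension F E] : Nonempty (InfPlacesOver E v) := by
  haveI : FiniteDimensional F E := Module.finite_of_finrank_eq_succ (Algebra.IsQuadraticExtension.finrank_eq_two F E)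
  obtain ⟨w, hw⟩ := InfinitePlace.comap_surjective (k := F) (K := E) v
  exact ⟨⟨w, hw⟩⟩

/-- **The local base-change maps `ι_w : F_v →+* E_w`** for `w ∣ v` infinite (Mathlib `LiesOver.completionMap`). [folklore] -/
def toInfPlace (w : InfPlacesOver E v) : v.Completion →+* w.1.Completion :=
  @NumberField.LiesOver.completionMap F E _ _ _ v w.1 (InfPlacesOver.liesOver E v w)

omit [NumberField F] [NumberField E] in
/-- `ι_w` extends `F → E`. [folklore] -/
theorem toInfPlace_coe (w : InfPlacesOver E v) (x : F) :
    toInfPlace E v w (x : v.Completion) = ((algebraMap F E x : E) : w.1.Completion) :=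
  @NumberField.LiesOver.completionMap_coe F E _ _ _ v w.1 (InfPlacesOver.liesOver E v w) (WithAbs.toAbs _ x)

omit [NumberField F] [NumberField E] in
/-- `ι_w` is continuous. [folklore] -/
theorem continuous_toInfPlace (w : InfPlacesOver E v) : Continuous (toInfPlace E v w) :=
  @NumberField.LiesOver.continuous_completionMap F E _ _ _ v w.1 (InfPlacesOver.liesOver E v w)

omit [NumberField F] [NumberField E] in
/-- The tree's base change of infinite adeles, read at a place above `v`: `(x ⊗ 1)_w = ι_w (x_v)`. [folklore] -/
theorem infiniteAdele_baseChange_apply_placesOver (x : InfiniteAdeleRing F) (w : InfPlacesOver E v) :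
    InfiniteAdeleRing.baseChange F E x w.1 = toInfPlace E v w (x v) := by
  obtain ⟨w, rfl⟩ := w
  rfl

/-- `E_w` as an `F_v`-algebra through `ι_w`, for `w : InfPlacesOver E v` (instance; it agrees definitionally with
Mathlib's scoped `NumberField.LiesOver` instance at the `LiesOver` witness `InfPlacesOver.liesOver`). [folklore] -/
instance algebraInfCompletion (w : InfPlacesOver E v) : Algebra v.Completion w.1.Completion :=
  (toInfPlace E v w).toAlgebra

omit [NumberField F] [NumberField E] in
/-- The structure map of `E_w / F_v` is `ι_w` (definitional). [folklore] -/
theorem algebraMap_infCompletion_eq (w : InfPlacesOver E v) :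
    algebraMap v.Completion w.1.Completion = toInfPlace E v w := rfl

omit [NumberField F] [NumberField E] in
/-- `E_w` is a topological `F_v`-module (instance). [folklore] -/
instance continuousSMul_infCompletion (w : InfPlacesOver E v) : ContinuousSMul v.Completion w.1.Completion :=
  ⟨((continuous_toInfPlace E v w).comp continuous_fst).mul continuous_snd⟩

omit [NumberField F] [NumberField E] in
/-- The structure map `ι_v : F_v → ∏_{w ∣ v} E_w` is `(ι_w)_w` (definitional). [folklore] -/
theorem algebraMap_infLocalRing_apply (a : v.Completion) (w : InfPlacesOver E v) :
    algebraMap v.Completion (InfLocalRing E v) a w = toInfPlace E v w a := rfl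

omit [NumberField F] [NumberField E] in
/-- `ι_v : F_v → ∏_{w ∣ v} E_w` is continuous. [folklore] -/
theorem continuous_algebraMap_infLocalRing : Continuous (algebraMap v.Completion (InfLocalRing E v)) :=
  continuous_pi fun w => continuous_toInfPlace E v w

omit [NumberField F] [NumberField E] in
/-- The local degrees `[E_w : F_v]` (`= 1` or `2`) are positive. [folklore] -/
theorem inertiaDeg_pos (w : InfPlacesOver E v) : 0 < v.inertiaDeg w.1 := by
  have hw : w.1 ∈ v.placesOver E := InfPlacesOver.liesOver E v w
  rw [← union_ramifiedPlacesOver_unramifiedPlacesOver] at hw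
  rcases hw with hw | hw
  · rw [inertiaDeg_eq_two hw]; exact two_pos
  · rw [inertiaDeg_eq_one hw]; exact one_pos

omit [NumberField F] [NumberField E] in
/-- `[E_w : F_v] = f(w|v)`, Mathlib's `inertiaDeg` at an infinite place (our `F_v`-structure on `E_w` is Mathlib's
scoped `NumberField.LiesOver` one at the witness `InfPlacesOver.liesOver`). [folklore] -/
theorem finrank_infCompletion_eq_inertiaDeg (w : InfPlacesOver E v) :
    Module.finrank v.Completion w.1.Completion = v.inertiaDeg w.1 :=
  (@inertiaDeg_eq_finrank F E _ _ _ v w.1 (InfPlacesOver.liesOver E v w)).symm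

omit [NumberField F] [NumberField E] in
/-- `[E_w : F_v] = f(w|v) > 0`, so `E_w` is a finite-dimensional `F_v`-space (instance). [folklore] -/
instance moduleFinite_infCompletion (w : InfPlacesOver E v) : Module.Finite v.Completion w.1.Completion := by
  refine Module.finite_of_finrank_pos ?_
  rw [finrank_infCompletion_eq_inertiaDeg]
  exact inertiaDeg_pos E v w

/-- **The local degree formula at an infinite place**: `dim_{F_v} ∏_{w ∣ v} E_w = ∑_{w ∣ v} [E_w : F_v] = [E : F]`
(Mathlib `NumberField.InfinitePlace.sum_inertiaDeg_eq_finrank`). [folklore] -/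
theorem finrank_infLocalRing : Module.finrank v.Completion (InfLocalRing E v) = Module.finrank F E := by
  classical
  rw [Module.finrank_pi_fintype v.Completion]
  simp_rw [finrank_infCompletion_eq_inertiaDeg]
  rw [← sum_inertiaDeg_eq_finrank F E v]
  exact (Finset.sum_subtype _ (fun w => by rw [Set.mem_toFinset, mem_placesOver_iff]) _).symm

omit [NumberField F] [NumberField E] in
/-- `‖2‖ = 2` in `F_v` for `v ∣ ∞`. [folklore] -/
theorem norm_two_completion : ‖(2 : v.Completion)‖ = 2 := by
  rw [← (Completion.isometry_extensionEmbedding v).norm_map_of_map_zero (map_zero _) 2, map_ofNat, Complex.norm_two]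

omit [NumberField F] [NumberField E] in
/-- `F_v` is a nontrivially normed field for `v ∣ ∞` (instance; Mathlib records only `NormedField`). [folklore] -/
instance nontriviallyNormedField_completion : NontriviallyNormedField v.Completion :=
  NontriviallyNormedField.ofNormNeOne <| by
    refine ⟨2, fun h => ?_, ?_⟩
    · have h2 := norm_two_completion (F := F) v
      rw [h, norm_zero] at h2
      exact two_ne_zero h2.symm
    · rw [norm_two_completion (F := F) v]
      norm_num

omit [NumberField F] in
/-- **Weak approximation at the infinite places above `v`**: `E` is dense in `∏_{w ∣ v} E_w`
(Mathlib `InfiniteAdeleRing.denseRange_algebraMap` projected to the places above `v`). [folklore] -/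
theorem denseRange_algebraMap_infLocalRing : DenseRange (algebraMap E (InfLocalRing E v)) := by
  classical
  let p : InfiniteAdeleRing E → InfLocalRing E v := fun x w => x w.1
  have hp : Continuous p := continuous_pi fun w => continuous_apply w.1
  have hps : Function.Surjective p := fun y =>
    ⟨fun w' => if h : w'.comap (algebraMap F E) = v then y ⟨w', h⟩ else 0, funext fun w => dif_pos w.2⟩
  have h := hps.denseRange.comp (InfiniteAdeleRing.denseRange_algebraMap E) hp
  have hfun : p ∘ (algebraMap E (InfiniteAdeleRing E)) = algebraMap E (InfLocalRing E v) := funext fun e => rfl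
  rwa [hfun] at h

/-- **`Ψ_v : F_v × F_v → ∏_{w ∣ v} E_w`, `(a, b) ↦ ι_v a + ι_v b · δ`** (`F_v`-linear), `v ∣ ∞`. [folklore] -/
def quadraticInfLocalMap (δ : E) : (v.Completion × v.Completion) →ₗ[v.Completion] InfLocalRing E v :=
  (LinearMap.fst _ _ _).smulRight (1 : InfLocalRing E v) +
    (LinearMap.snd _ _ _).smulRight (algebraMap E (InfLocalRing E v) δ)

omit [NumberField F] [NumberField E] in
/-- `Ψ_v (a, b) = ι_v a + ι_v b · δ`. [folklore] -/
theorem quadraticInfLocalMap_apply (δ : E) (p : v.Completion × v.Completion) :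
    quadraticInfLocalMap E v δ p = algebraMap v.Completion (InfLocalRing E v) p.1 +
      algebraMap v.Completion (InfLocalRing E v) p.2 * algebraMap E (InfLocalRing E v) δ := by
  simp only [quadraticInfLocalMap, LinearMap.add_apply, LinearMap.smulRight_apply, LinearMap.fst_apply,
    LinearMap.snd_apply, Algebra.smul_def, mul_one]

omit [NumberField F] [NumberField E] in
/-- Components: `Ψ_v (a, b)_w = ι_w a + ι_w b · δ`. [folklore] -/
theorem quadraticInfLocalMap_apply_apply (δ : E) (p : v.Completion × v.Completion) (w : InfPlacesOver E v) :
    quadraticInfLocalMap E v δ p w = toInfPlace E v w p.1 + toInfPlace E v w p.2 * ((δ : E) : w.1.Completion) := by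
  rw [quadraticInfLocalMap_apply]
  rfl

omit [NumberField F] [NumberField E] in
/-- `Ψ_v` is continuous. [folklore] -/
theorem continuous_quadraticInfLocalMap (δ : E) : Continuous (quadraticInfLocalMap E v δ) := by
  have : (quadraticInfLocalMap E v δ : (v.Completion × v.Completion) → InfLocalRing E v) =
      fun p => algebraMap v.Completion (InfLocalRing E v) p.1 +
        algebraMap v.Completion (InfLocalRing E v) p.2 * algebraMap E (InfLocalRing E v) δ :=
    funext (quadraticInfLocalMap_apply E v δ)
  rw [this]
  exact ((continuous_algebraMap_infLocalRing E v).comp continuous_fst).add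
    (((continuous_algebraMap_infLocalRing E v).comp continuous_snd).mul continuous_const)

omit [NumberField F] [NumberField E] in
/-- `Ψ_v` on `E = F ⊕ F δ`: `Ψ_v (x, y) = (x + y δ) ⊗ 1` for `x, y ∈ F`. [folklore] -/
theorem quadraticInfLocalMap_coe (δ : E) (x y : F) :
    quadraticInfLocalMap E v δ ((x : v.Completion), (y : v.Completion)) =
      algebraMap E (InfLocalRing E v) (algebraMap F E x + algebraMap F E y * δ) := by
  funext w
  rw [quadraticInfLocalMap_apply_apply, toInfPlace_coe, toInfPlace_coe, Pi.algebraMap_apply, map_add, map_mul]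
  rfl

/-- **Surjectivity of `Ψ_v`** (`v ∣ ∞`, quadratic `E/F`, `δ ∉ F`): the range is a closed `F_v`-subspace containing the
dense image of `E = F ⊕ F δ`. [folklore] -/
theorem quadraticInfLocalMap_surjective [Algebra.IsQuadraticExtension F E] {δ : E}
    (hδF : δ ∉ Set.range (algebraMap F E)) : Function.Surjective (quadraticInfLocalMap E v δ) := by
  set Ψ := quadraticInfLocalMap E v δ with hΨ
  have hclosed : IsClosed (Set.range Ψ) := by
    change IsClosed ((LinearMap.range Ψ : Submodule v.Completion (InfLocalRing E v)) : Set (InfLocalRing E v))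
    exact Submodule.closed_of_finiteDimensional (𝕜 := v.Completion) (E := InfLocalRing E v) (LinearMap.range Ψ)
  have hE : ∀ e : E, algebraMap E (InfLocalRing E v) e ∈ Set.range Ψ := fun e => by
    obtain ⟨x, y, rfl⟩ := exists_eq_add_mul_of_isQuadraticExtension E hδF e
    exact ⟨((x : v.Completion), (y : v.Completion)), quadraticInfLocalMap_coe E v δ x y⟩
  have hdense : Dense (Set.range Ψ) :=
    (denseRange_algebraMap_infLocalRing E v).mono (Set.range_subset_iff.mpr hE)
  intro z
  have hz : z ∈ Set.range Ψ := by
    rw [← hclosed.closure_eq, hdense.closure_eq]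
    exact Set.mem_univ z
  exact hz

/-- `dim_{F_v} ∏_{w ∣ v} E_w = 2` for quadratic `E/F`. [folklore] -/
theorem finrank_infLocalRing_eq_two [Algebra.IsQuadraticExtension F E] :
    Module.finrank v.Completion (InfLocalRing E v) = 2 := by
  rw [finrank_infLocalRing, Algebra.IsQuadraticExtension.finrank_eq_two]

/-- **Injectivity of `Ψ_v`** (`v ∣ ∞`): a surjective linear map `F_v² → ∏_{w ∣ v} E_w` between spaces of the same
dimension `2 = [E : F] = ∑_{w ∣ v} [E_w : F_v]`. [folklore] -/
theorem quadraticInfLocalMap_injective [Algebra.IsQuadraticExtension F E] {δ : E}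
    (hδF : δ ∉ Set.range (algebraMap F E)) : Function.Injective (quadraticInfLocalMap E v δ) :=
  (LinearMap.injective_iff_surjective_of_finrank_eq_finrank
    (by rw [Module.finrank_prod, Module.finrank_self, finrank_infLocalRing_eq_two])).mpr
    (quadraticInfLocalMap_surjective E v hδF)

/-- **`E ⊗_F F_v = F_v ⊕ F_v δ` at an infinite place**: for a quadratic extension `E/F` of number fields and
`δ ∈ E ∖ F`, `(a, b) ↦ ι_v a + ι_v b · δ` is an isomorphism of topological `F_v`-modules
`F_v × F_v ≃ ∏_{w ∣ v} E_w`. [cite: CasselsFrohlichANT1967, Ch. II §10] -/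
def quadraticInfLocalEquiv [Algebra.IsQuadraticExtension F E] {δ : E} (hδF : δ ∉ Set.range (algebraMap F E)) :
    (v.Completion × v.Completion) ≃L[v.Completion] InfLocalRing E v :=
  (LinearEquiv.ofBijective (quadraticInfLocalMap E v δ)
    ⟨quadraticInfLocalMap_injective E v hδF, quadraticInfLocalMap_surjective E v hδF⟩).toContinuousLinearEquiv

/-- `quadraticInfLocalEquiv` is `Ψ_v` (definitional). [folklore] -/
theorem coe_quadraticInfLocalEquiv [Algebra.IsQuadraticExtension F E] {δ : E}
    (hδF : δ ∉ Set.range (algebraMap F E)) :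
    ⇑(quadraticInfLocalEquiv E v hδF) = quadraticInfLocalMap E v δ := rfl

/-- `quadraticInfLocalEquiv (a, b) = ι_v a + ι_v b · δ`. [folklore] -/
@[simp] theorem quadraticInfLocalEquiv_apply [Algebra.IsQuadraticExtension F E] {δ : E}
    (hδF : δ ∉ Set.range (algebraMap F E)) (p : v.Completion × v.Completion) :
    quadraticInfLocalEquiv E v hδF p = algebraMap v.Completion (InfLocalRing E v) p.1 +
      algebraMap v.Completion (InfLocalRing E v) p.2 * algebraMap E (InfLocalRing E v) δ :=
  quadraticInfLocalMap_apply E v δ p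

/-- **`∏_{w ∣ v} E_w` is a quadratic extension of `F_v`** for `v ∣ ∞` (free of rank `2`, instance). [folklore] -/
instance isQuadraticExtension_infLocalRing [Algebra.IsQuadraticExtension F E] :
    Algebra.IsQuadraticExtension v.Completion (InfLocalRing E v) where
  finrank_eq_two' := finrank_infLocalRing_eq_two E v

end Archimedean

/-! ## B. The infinite adeles: `E_∞ = F_∞ ⊕ F_∞ δ` -/

section InfiniteAdele

open NumberField.InfinitePlace

variable (F) in
/-- **`Ψ_∞ : F_∞ × F_∞ → E_∞`, `(a, b) ↦ (a ⊗ 1) + (b ⊗ 1) · δ`** (additive; `a ⊗ 1` is the tree's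
`InfiniteAdeleRing.baseChange`). [folklore] -/
def quadraticInfiniteAdeleMap (δ : E) : (InfiniteAdeleRing F × InfiniteAdeleRing F) →+ InfiniteAdeleRing E where
  toFun p := InfiniteAdeleRing.baseChange F E p.1 +
    InfiniteAdeleRing.baseChange F E p.2 * algebraMap E (InfiniteAdeleRing E) δ
  map_zero' := by simp only [Prod.fst_zero, Prod.snd_zero, map_zero, zero_mul, add_zero]
  map_add' p q := by
    simp only [Prod.fst_add, Prod.snd_add, map_add]
    ring

omit [NumberField F] [NumberField E] in
/-- `Ψ_∞ (a, b) = (a ⊗ 1) + (b ⊗ 1) · δ` (definitional). [folklore] -/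
@[simp] theorem quadraticInfiniteAdeleMap_apply (δ : E) (p : InfiniteAdeleRing F × InfiniteAdeleRing F) :
    quadraticInfiniteAdeleMap F E δ p = InfiniteAdeleRing.baseChange F E p.1 +
      InfiniteAdeleRing.baseChange F E p.2 * algebraMap E (InfiniteAdeleRing E) δ := rfl

omit [NumberField F] [NumberField E] in
/-- **`Ψ_∞` is `Ψ_v` at the places above `v`**: `Ψ_∞ (a, b)_w = Ψ_v (a_v, b_v)_w` for `w ∣ v`. [folklore] -/
theorem quadraticInfiniteAdeleMap_apply_placesOver (δ : E) (p : InfiniteAdeleRing F × InfiniteAdeleRing F)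
    (v : InfinitePlace F) (w : InfPlacesOver E v) :
    quadraticInfiniteAdeleMap F E δ p w.1 = quadraticInfLocalMap E v δ (p.1 v, p.2 v) w := by
  rw [quadraticInfLocalMap_apply_apply, quadraticInfiniteAdeleMap_apply]
  change InfiniteAdeleRing.baseChange F E p.1 w.1 +
    InfiniteAdeleRing.baseChange F E p.2 w.1 * algebraMap E (InfiniteAdeleRing E) δ w.1 = _
  rw [infiniteAdele_baseChange_apply_placesOver, infiniteAdele_baseChange_apply_placesOver,
    InfiniteAdeleRing.algebraMap_apply]

omit [NumberField F] [NumberField E] in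
/-- `Ψ_∞` is continuous. [folklore] -/
theorem continuous_quadraticInfiniteAdeleMap (δ : E) : Continuous (quadraticInfiniteAdeleMap F E δ) :=
  ((InfiniteAdeleRing.continuous_baseChange F E).comp continuous_fst).add
    (((InfiniteAdeleRing.continuous_baseChange F E).comp continuous_snd).mul continuous_const)

omit [NumberField F] [NumberField E] in
/-- `Ψ_∞` is `(· ⊗ 1)`-semilinear: `Ψ_∞ (c a, c b) = (c ⊗ 1) Ψ_∞ (a, b)`. [folklore] -/
theorem quadraticInfiniteAdeleMap_smul (δ : E) (c : InfiniteAdeleRing F) (p : InfiniteAdeleRing F × InfiniteAdeleRing F) :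
    quadraticInfiniteAdeleMap F E δ (c • p) = InfiniteAdeleRing.baseChange F E c * quadraticInfiniteAdeleMap F E δ p := by
  rw [quadraticInfiniteAdeleMap_apply, quadraticInfiniteAdeleMap_apply, Prod.smul_fst, Prod.smul_snd, smul_eq_mul,
    smul_eq_mul, map_mul, map_mul]
  ring

omit [NumberField F] [NumberField E] in
/-- `Ψ_∞` on the diagonal image of `E = F ⊕ F δ`: `Ψ_∞ (x, y) = x + y δ` for `x, y ∈ F`. [folklore] -/
theorem quadraticInfiniteAdeleMap_algebraMap (δ : E) (x y : F) :
    quadraticInfiniteAdeleMap F E δ (algebraMap F (InfiniteAdeleRing F) x, algebraMap F (InfiniteAdeleRing F) y) =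
      algebraMap E (InfiniteAdeleRing E) (algebraMap F E x + algebraMap F E y * δ) := by
  rw [quadraticInfiniteAdeleMap_apply, InfiniteAdeleRing.baseChange_algebraMap, InfiniteAdeleRing.baseChange_algebraMap,
    map_add, map_mul]

omit [NumberField F] [NumberField E] in
/-- **Multiplication by `δ`** in the coordinates: `δ · Ψ_∞ (a, b) = Ψ_∞ (d b, a)` for `δ² = d ∈ F`. [folklore] -/
theorem algebraMap_mul_quadraticInfiniteAdeleMap {δ : E} {d : F} (hd : δ * δ = algebraMap F E d)
    (a b : InfiniteAdeleRing F) :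
    algebraMap E (InfiniteAdeleRing E) δ * quadraticInfiniteAdeleMap F E δ (a, b) =
      quadraticInfiniteAdeleMap F E δ (algebraMap F (InfiniteAdeleRing F) d * b, a) := by
  rw [quadraticInfiniteAdeleMap_apply, quadraticInfiniteAdeleMap_apply]
  dsimp only
  rw [map_mul (InfiniteAdeleRing.baseChange F E), InfiniteAdeleRing.baseChange_algebraMap, ← hd,
    map_mul (algebraMap E (InfiniteAdeleRing E))]
  ring

/-- **Injectivity of `Ψ_∞`**, from the local injectivity at each `v ∣ ∞`. [folklore] -/
theorem quadraticInfiniteAdeleMap_injective [Algebra.IsQuadraticExtension F E] {δ : E}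
    (hδF : δ ∉ Set.range (algebraMap F E)) : Function.Injective (quadraticInfiniteAdeleMap F E δ) := by
  rw [injective_iff_map_eq_zero]
  rintro ⟨a, b⟩ h
  have hv : ∀ v : InfinitePlace F, (a v, b v) = 0 := fun v =>
    quadraticInfLocalMap_injective E v hδF (by
      rw [map_zero]
      funext w
      have h' := quadraticInfiniteAdeleMap_apply_placesOver E δ (a, b) v w
      rw [h] at h'
      exact h'.symm)
  exact Prod.ext (funext fun v => (Prod.mk_eq_zero.mp (hv v)).1) (funext fun v => (Prod.mk_eq_zero.mp (hv v)).2)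

/-- The inverse of `Ψ_∞`, assembled from the local inverses `Ψ_v⁻¹`, `v ∣ ∞`. [folklore] -/
def quadraticInfiniteAdeleInv [Algebra.IsQuadraticExtension F E] {δ : E} (hδF : δ ∉ Set.range (algebraMap F E))
    (y : InfiniteAdeleRing E) : InfiniteAdeleRing F × InfiniteAdeleRing F :=
  (fun v => ((quadraticInfLocalEquiv E v hδF).symm fun w => y w.1).1,
    fun v => ((quadraticInfLocalEquiv E v hδF).symm fun w => y w.1).2)

/-- `Ψ_∞ ∘ Ψ_∞⁻¹ = id`. [folklore] -/
theorem quadraticInfiniteAdeleMap_inv [Algebra.IsQuadraticExtension F E] {δ : E}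
    (hδF : δ ∉ Set.range (algebraMap F E)) (y : InfiniteAdeleRing E) :
    quadraticInfiniteAdeleMap F E δ (quadraticInfiniteAdeleInv E hδF y) = y := by
  funext w'
  have h := quadraticInfiniteAdeleMap_apply_placesOver E δ (quadraticInfiniteAdeleInv E hδF y)
    (w'.comap (algebraMap F E)) ⟨w', rfl⟩
  dsimp only at h
  rw [h, quadraticInfiniteAdeleInv]
  dsimp only
  rw [Prod.mk.eta, ← coe_quadraticInfLocalEquiv E _ hδF, ContinuousLinearEquiv.apply_symm_apply]

/-- **Surjectivity of `Ψ_∞`**. [folklore] -/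
theorem quadraticInfiniteAdeleMap_surjective [Algebra.IsQuadraticExtension F E] {δ : E}
    (hδF : δ ∉ Set.range (algebraMap F E)) : Function.Surjective (quadraticInfiniteAdeleMap F E δ) :=
  fun y => ⟨quadraticInfiniteAdeleInv E hδF y, quadraticInfiniteAdeleMap_inv E hδF y⟩

/-- `Ψ_∞⁻¹` is continuous (finite products of the continuous `Ψ_v⁻¹`). [folklore] -/
theorem continuous_quadraticInfiniteAdeleInv [Algebra.IsQuadraticExtension F E] {δ : E}
    (hδF : δ ∉ Set.range (algebraMap F E)) : Continuous (quadraticInfiniteAdeleInv E hδF) := by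
  have hres : ∀ v : InfinitePlace F, Continuous fun y : InfiniteAdeleRing E => fun w : InfPlacesOver E v => y w.1 :=
    fun v => continuous_pi fun w => continuous_apply w.1
  exact (continuous_pi fun v => continuous_fst.comp
      ((quadraticInfLocalEquiv E v hδF).symm.continuous.comp (hres v))).prodMk
    (continuous_pi fun v => continuous_snd.comp ((quadraticInfLocalEquiv E v hδF).symm.continuous.comp (hres v)))

variable (F) in
/-- **`E_∞ = F_∞ ⊕ F_∞ δ`**: for a quadratic extension `E/F` of number fields and `δ ∈ E ∖ F`, `Ψ_∞` is an
isomorphism of topological groups `F_∞ × F_∞ ≃ₜ+ E_∞` — the archimedean part of `𝔸_E = 𝔸_F ⊗_F E` in the basis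
`(1, δ)`. [cite: CasselsFrohlichANT1967, Ch. II §14] -/
def quadraticInfiniteAdeleEquiv [Algebra.IsQuadraticExtension F E] {δ : E} (hδF : δ ∉ Set.range (algebraMap F E)) :
    (InfiniteAdeleRing F × InfiniteAdeleRing F) ≃ₜ+ InfiniteAdeleRing E :=
  { toFun := quadraticInfiniteAdeleMap F E δ
    invFun := quadraticInfiniteAdeleInv E hδF
    left_inv := fun _ => quadraticInfiniteAdeleMap_injective E hδF (quadraticInfiniteAdeleMap_inv E hδF _)
    right_inv := quadraticInfiniteAdeleMap_inv E hδF
    map_add' := map_add (quadraticInfiniteAdeleMap F E δ)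
    continuous_toFun := continuous_quadraticInfiniteAdeleMap E δ
    continuous_invFun := continuous_quadraticInfiniteAdeleInv E hδF }

/-- `quadraticInfiniteAdeleEquiv` is `Ψ_∞`. [folklore] -/
@[simp] theorem quadraticInfiniteAdeleEquiv_apply [Algebra.IsQuadraticExtension F E] {δ : E}
    (hδF : δ ∉ Set.range (algebraMap F E)) (p : InfiniteAdeleRing F × InfiniteAdeleRing F) :
    quadraticInfiniteAdeleEquiv F E hδF p = InfiniteAdeleRing.baseChange F E p.1 +
      InfiniteAdeleRing.baseChange F E p.2 * algebraMap E (InfiniteAdeleRing E) δ := rfl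

/-- The local coordinates of `Ψ_∞⁻¹ y` at `v` are `Ψ_v⁻¹ (y_w)_{w ∣ v}`. [folklore] -/
theorem quadraticInfiniteAdeleEquiv_symm_apply_local [Algebra.IsQuadraticExtension F E] {δ : E}
    (hδF : δ ∉ Set.range (algebraMap F E)) (y : InfiniteAdeleRing E) (v : InfinitePlace F) :
    (((quadraticInfiniteAdeleEquiv F E hδF).symm y).1 v, ((quadraticInfiniteAdeleEquiv F E hδF).symm y).2 v) =
      (quadraticInfLocalEquiv E v hδF).symm fun w => y w.1 :=
  Prod.mk.eta

/-- Every infinite adele of `E` is uniquely `(a ⊗ 1) + (b ⊗ 1) · δ` with `a, b ∈ F_∞`. [folklore] -/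
theorem existsUnique_eq_infiniteBaseChange_add [Algebra.IsQuadraticExtension F E] {δ : E}
    (hδF : δ ∉ Set.range (algebraMap F E)) (y : InfiniteAdeleRing E) :
    ∃! p : InfiniteAdeleRing F × InfiniteAdeleRing F, y = InfiniteAdeleRing.baseChange F E p.1 +
      InfiniteAdeleRing.baseChange F E p.2 * algebraMap E (InfiniteAdeleRing E) δ := by
  refine ⟨(quadraticInfiniteAdeleEquiv F E hδF).symm y, ?_, fun p hp => ?_⟩
  · change y = _
    rw [← quadraticInfiniteAdeleEquiv_apply E hδF, ContinuousAddEquiv.apply_symm_apply]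
  · change y = _ at hp
    rw [← quadraticInfiniteAdeleEquiv_apply E hδF] at hp
    rw [hp, ContinuousAddEquiv.symm_apply_apply]

end InfiniteAdele

end UnitaryGroup

end Literature.NumberTheory.Automorphic

end
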